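import Literature.MathematicalPhysics.QuantumManyBody.BoseGasFreeDirichletBEC
import HarnessLib

/-!
# Route `BECRieszReverseHolder`, crux `MicroscaleFlatness` (stmt-AtomisticToContinuum-12842),
# line registered (`Lines/birth.lean`): the registered stub `stub_sliceKinetic_le_energy`

Supports (does not close) stmt-AtomisticToContinuum-12842; stub `stub_sliceKinetic_le_energy` of
the birth line of crux MicroscaleFlatness, route BECRieszReverseHolder.

**The tagged particle carries exactly `1/N` of the kinetic energy.** For every pair potential
`v : ℝ → ℝ≥0∞`, every `n, L` and every trial state `Ψ ∈ TrialState (n+1) L`,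

`(n+1) · ∫ dX ∫ dy |∇₀Ψ(y :: X)|² ≤ ⟨Ψ, H Ψ⟩ = energy v Ψ`.

Proof: Tonelli along `Matrix.vecCons` (`lintegral_lintegral_swap` with the joint measurability
`measurable_vecCons`, then `lintegral_lintegral_vecCons`) turns the iterated integral into
`∫ |∇₀Ψ|²`; Bose symmetry (`lintegral_kineticDensity_eq_mul`, from `Ψ.symm` and
`kineticDensity = ∑ᵢ partialGradSq i`) gives `∫ kineticDensity Ψ = (n+1) ∫ |∇₀Ψ|²`; finally the
interaction term of `energy` is `≥ 0` (`lintegral_mono` with `le_self_add`). No positivity of `L`,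
no normalisation and no hypothesis on `v` is used.

## References

* [LSSY2005] E. H. Lieb, R. Seiringer, J. P. Solovej, J. Yngvason, *The Mathematics of the Bose
  Gas and its Condensation* (2005), §1.2 (1.16)–(1.17) (energy functional, Bose symmetry).
-/

noncomputable section

namespace Summit.AtomisticToContinuum.BoseEinsteinCondensation.Theorems.MicroscaleFlatness

open MeasureTheory
open scoped ENNReal
open Literature.MathematicalPhysics.QuantumManyBody.BoseGas

/-- Tonelli along `Matrix.vecCons`, environment outermost:
`∫ dX ∫ dy F(y :: X) = ∫ F(Z) dZ` for measurable `F ≥ 0` on `(ℝ³)^{n+1}`. [folklore] -/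
theorem lintegral_lintegral_vecCons_swap {n : ℕ} {F : Config (n + 1) → ℝ≥0∞}
    (hF : Measurable F) :
    ∫⁻ X : Config n, ∫⁻ y : Space, F (Matrix.vecCons y X) = ∫⁻ Z, F Z := by
  rw [← lintegral_lintegral_vecCons hF]
  symm
  exact lintegral_lintegral_swap ((hF.comp measurable_vecCons).aemeasurable)

/-- **Bose symmetry: the tagged particle carries `1/N` of the kinetic energy**, as an equality:
`(n+1) · ∫ dX ∫ dy |∇₀Ψ(y :: X)|² = ∫ |∇Ψ|²` for a Bose-symmetric differentiable `Ψ` on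
`(ℝ³)^{n+1}`. [cite: LSSY2005, §1.2 (1.16)–(1.17)] -/
theorem mul_sliceKinetic_eq_lintegral_kineticDensity {n : ℕ} {Ψ : Config (n + 1) → ℂ}
    (hΨ : Differentiable ℝ Ψ)
    (hsymm : ∀ (σ : Equiv.Perm (Fin (n + 1))) (X : Config (n + 1)), Ψ (X ∘ σ) = Ψ X) :
    ((n + 1 : ℕ) : ℝ≥0∞) * ∫⁻ X : Config n, ∫⁻ y : Space, partialGradSq 0 Ψ (Matrix.vecCons y X) =
      ∫⁻ Z, kineticDensity Ψ Z := by
  rw [lintegral_lintegral_vecCons_swap (measurable_partialGradSq 0 Ψ),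
    lintegral_kineticDensity_eq_mul hΨ hsymm]
  push_cast
  rfl

/-- **STUB 2 of the birth line — the tagged particle carries `1/N` of the energy.** For every
trial state `Ψ` of `n+1` bosons in `Λ_L` and every pair potential `v ≥ 0`,
`(n+1) · ∫ dX ∫ dy |∇₀Ψ(y :: X)|² ≤ ⟨Ψ, H Ψ⟩ = energy v Ψ`: the left side equals the kinetic
energy `∫ |∇Ψ|²` (`mul_sliceKinetic_eq_lintegral_kineticDensity`, using `Ψ.contDiff` and
`Ψ.symm`), and the interaction term is nonnegative. [cite: LSSY2005, §1.2 (1.16)–(1.17)] -/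
theorem stub_sliceKinetic_le_energy :
    ∀ (v : ℝ → ENNReal) (n : ℕ) (L : ℝ)
      (Ψ : Literature.MathematicalPhysics.QuantumManyBody.BoseGas.TrialState (n + 1) L),
      ((n + 1 : ℕ) : ENNReal) *
          ∫⁻ X : Fin n → EuclideanSpace ℝ (Fin 3), ∫⁻ y : EuclideanSpace ℝ (Fin 3),
            Literature.MathematicalPhysics.QuantumManyBody.BoseGas.partialGradSq 0 Ψ.ψ (Matrix.vecCons y X) ≤
        Literature.MathematicalPhysics.QuantumManyBody.BoseGas.energy v Ψ := by
  intro v n L Ψ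
  rw [mul_sliceKinetic_eq_lintegral_kineticDensity (Ψ.contDiff.differentiable one_ne_zero) Ψ.symm]
  exact lintegral_mono fun Z => le_self_add

end Summit.AtomisticToContinuum.BoseEinsteinCondensation.Theorems.MicroscaleFlatness
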